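import Literature.Combinatorics.StablePolynomials.HThetaStability
import HarnessLib

/-!
# Stability preservers for the open right half-plane: the symbol `T[(1+zw)^κ]`
(Borcea–Brändén II, Theorem 3.2, `C = H_{π/2}`)

J. Borcea, P. Brändén, *The Lee–Yang and Pólya–Schur programs. II. Theory of stable polynomials and
applications*, Comm. Pure Appl. Math. 62 (2009) 1595–1631 (arXiv:0809.3087), §3:

> **Theorem 3.2.** Let `κ ∈ ℕⁿ`, `T : ℂ_κ[z_1,…,z_n] → ℂ[z_1,…,z_n]` be a linear operator, and `C = 𝔻` or
> `H_{π/2}`. Then `T` preserves `C`-stability if and only if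
> (a) `T` has range of dimension at most one and is of the form `T(f) = α(f)P`, where `α` is a linear
> functional on `ℂ_κ[z_1,…,z_n]` and `P` is a `C`-stable polynomial, or
> (b) the polynomial (in `2n` variables) `T[(1+zw)^κ] := Σ_{α ≤ κ} binom(κ,α) T(z^α) w^α` is `C`-stable.
>
> … (for `H_{π/2}` it is often more convenient – but equivalent – to choose `T[(1+zw)^κ]` rather than
> `T[(z+w)^κ]`, cf. [BB-I]).

and part I (Invent. Math. 177 (2009), arXiv:0809.0401), §6.1 Remark 6.1: for the open right half-plane the
symbol `T[(1+zw)^κ]` is "often more convenient (but equivalent)" to `G_T(z,w) = T[(z+w)^κ]`.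

This file treats the case `C = H_{π/2}` (the open right half-plane `{Re z > 0}`, tree spelling
`IsHThetaStable (π/2)`). The tree already has Theorem 3.1 of part II for every `H_θ` with the symbol
`T[(z+w)^κ]` (`BorceaBranden_hThetaStabilityPreserver_iff`, `boundedDegreeSymbol`); here we introduce the second
symbol `T[(1+zw)^κ]` (`boundedDegreeSymbolD`), prove the identity
`T[(1+zw)^κ](z,w) = w^κ · T[(z+w)^κ](z, 1/w)` behind the word "equivalent", deduce that for `H_{π/2}` the two
symbols are stable together (`w ↦ 1/w` preserves `Re w > 0`), and conclude Theorem 3.2 for `C = H_{π/2}` and every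
`κ ∈ ℕⁿ`.

-- TODO(general form): the case `C = 𝔻` of Theorem 3.2 rests on part I §6.1 (Möbius substitutions `Φ_κ`,
-- Lemma 6.2, Theorem 6.3), not yet in the tree.

## Contents

* `boundedDegreeSymbolD κ T` — `T[(1+zw)^κ]`; `apply_prod_one_add_C_mul_X_pow`, `eval_boundedDegreeSymbolD`.
* `eval_boundedDegreeSymbolD_eq_mul` — `T[(1+zw)^κ](z,w) = w^κ T[(z+w)^κ](z,1/w)` (`w_i ≠ 0`).
* `isHThetaStable_pi_div_two_boundedDegreeSymbolD_iff` — the two symbols are `H_{π/2}`-stable together.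
* **`BorceaBranden_rightHalfPlaneStabilityPreserver_iff`** — Theorem 3.2 (`C = H_{π/2}`), and its unfolded form
  `BorceaBranden_rightHalfPlaneStabilityPreserver_iff_re` (hypotheses `Re z_i > 0`).

## References

* [BorceaBranden2009II] J. Borcea, P. Brändén, Comm. Pure Appl. Math. 62 (2009) 1595–1631, §3 Thm 3.2.
* [BorceaBranden2009] J. Borcea, P. Brändén, Invent. Math. 177 (2009) 541–569, §6.1 Remark 6.1.
-/

noncomputable section

open MvPolynomial Finset

namespace Literature.Combinatorics.StablePolynomials

variable {τ : Type*} [Fintype τ] [DecidableEq τ]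

/-! ## §1 The symbol `T[(1+zw)^κ]` -/

/-- **The symbol `T[(1+zw)^κ] := Σ_{α ≤ κ} binom(κ,α) T(z^α)(z) w^α ∈ ℂ[z_τ, w_τ]`** (variables `τ ⊕ τ`,
`Sum.inl` = `z`, `Sum.inr` = `w`). [cite: BorceaBranden2009II, §3 Thm 3.2 (b), eq. (3.2)]
[cite: BorceaBranden2009, §6.1 Remark 6.1] -/
def boundedDegreeSymbolD (κ : τ → ℕ) (T : MvPolynomial τ ℂ →ₗ[ℂ] MvPolynomial τ ℂ) : MvPolynomial (τ ⊕ τ) ℂ :=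
  ∑ α ∈ Fintype.piFinset fun i => range (κ i + 1),
    (∏ i, (((κ i).choose (α i) : ℕ) : ℂ)) •
      (rename Sum.inl (T (∏ i, X i ^ α i)) * ∏ i, X (Sum.inr i) ^ α i)

/-- `(1+wz)^κ = Σ_{α ≤ κ} (Π_i binom(κ_i,α_i) w_i^{α_i}) z^α` and linearity of `T`.
[cite: BorceaBranden2009II, §3 eq. (3.2)] -/
theorem apply_prod_one_add_C_mul_X_pow (κ : τ → ℕ) (T : MvPolynomial τ ℂ →ₗ[ℂ] MvPolynomial τ ℂ) (w : τ → ℂ) :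
    T (∏ i, (1 + C (w i) * X i) ^ κ i) =
      ∑ α ∈ Fintype.piFinset fun i => range (κ i + 1),
        (∏ i, (((κ i).choose (α i) : ℕ) : ℂ) * w i ^ α i) • T (∏ i, X i ^ α i) := by
  have h : (∏ i, (1 + C (w i) * X i) ^ κ i : MvPolynomial τ ℂ) =
      ∑ α ∈ Fintype.piFinset fun i => range (κ i + 1),
        (∏ i, (((κ i).choose (α i) : ℕ) : ℂ) * w i ^ α i) • ∏ i, X i ^ α i := by
    have h1 : ∀ i, ((1 + C (w i) * X i) ^ κ i : MvPolynomial τ ℂ) =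
        ∑ k ∈ range (κ i + 1), C ((((κ i).choose k : ℕ) : ℂ) * w i ^ k) * X i ^ k := by
      intro i
      rw [add_comm, add_pow]
      refine sum_congr rfl fun k _ => ?_
      rw [one_pow, mul_one, mul_pow, ← C_pow, _root_.map_mul, map_natCast]
      ring
    simp only [h1]
    rw [prod_univ_sum]
    refine sum_congr rfl fun α _ => ?_
    rw [smul_eq_C_mul, _root_.map_prod C, ← prod_mul_distrib]
  rw [h, map_sum]
  simp only [map_smul]

/-- **`T[(1+zw)^κ](z,w) = T[Π_i (1 + w_i z_i)^{κ_i}](z)`** pointwise. [cite: BorceaBranden2009II, §3 eq. (3.2)] -/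
theorem eval_boundedDegreeSymbolD (κ : τ → ℕ) (T : MvPolynomial τ ℂ →ₗ[ℂ] MvPolynomial τ ℂ) (z w : τ → ℂ) :
    eval (Sum.elim z w) (boundedDegreeSymbolD κ T) = eval z (T (∏ i, (1 + C (w i) * X i) ^ κ i)) := by
  rw [apply_prod_one_add_C_mul_X_pow, map_sum, boundedDegreeSymbolD, map_sum]
  refine sum_congr rfl fun α _ => ?_
  rw [smul_eval, smul_eval, _root_.map_mul (eval (Sum.elim z w)), eval_rename,
    _root_.map_prod (eval (Sum.elim z w)), Sum.elim_comp_inl]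
  simp only [map_pow, eval_X, Sum.elim_inr]
  rw [prod_mul_distrib]
  ring

/-- `T[(1+zw)^κ]` is `H_θ`-stable iff `T[Π (1 + w_i z_i)^{κ_i}](z) ≠ 0` for `z, w ∈ H_θ^τ`.
[cite: BorceaBranden2009II, §3 Thm 3.2 (b)] -/
theorem isHThetaStable_boundedDegreeSymbolD_iff (θ : ℝ) (κ : τ → ℕ)
    (T : MvPolynomial τ ℂ →ₗ[ℂ] MvPolynomial τ ℂ) :
    IsHThetaStable θ (boundedDegreeSymbolD κ T) ↔
      ∀ z w : τ → ℂ, (∀ i, 0 < (thetaUnit θ * z i).im) → (∀ i, 0 < (thetaUnit θ * w i).im) →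
        eval z (T (∏ i, (1 + C (w i) * X i) ^ κ i)) ≠ 0 := by
  constructor
  · intro h z w hz hw
    have h' := h (Sum.elim z w) fun j => by
      rcases j with i | i
      · simpa only [Sum.elim_inl] using hz i
      · simpa only [Sum.elim_inr] using hw i
    rwa [eval_boundedDegreeSymbolD] at h'
  · intro h zw hzw
    rw [← Sum.elim_comp_inl_inr zw, eval_boundedDegreeSymbolD]
    exact h _ _ (fun i => hzw (Sum.inl i)) fun i => hzw (Sum.inr i)

/-! ## §2 `T[(1+zw)^κ](z,w) = w^κ · T[(z+w)^κ](z,1/w)` -/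

omit [DecidableEq τ] in
/-- `w^κ (z + 1/w)^κ = (1 + w z)^κ` coordinatewise, as polynomials (`w_i ≠ 0`).
[cite: BorceaBranden2009, §6.1 Remark 6.1] -/
theorem prod_pow_smul_prod_X_add_C_inv_pow (κ : τ → ℕ) {w : τ → ℂ} (hw : ∀ i, w i ≠ 0) :
    ((∏ i, w i ^ κ i) • ∏ i, (X i + C (w i)⁻¹) ^ κ i : MvPolynomial τ ℂ) = ∏ i, (1 + C (w i) * X i) ^ κ i := by
  rw [smul_eq_C_mul, _root_.map_prod C, ← prod_mul_distrib]
  refine prod_congr rfl fun i _ => ?_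
  rw [C_pow, ← mul_pow, mul_add, ← _root_.map_mul, mul_inv_cancel₀ (hw i), C_1, add_comm]

/-- **`T[(1+zw)^κ](z,w) = w^κ · T[(z+w)^κ](z, 1/w)`** for `w_i ≠ 0` — the identity making the two symbols
"equivalent" for the right half-plane. [cite: BorceaBranden2009, §6.1 Remark 6.1]
[cite: BorceaBranden2009II, §3 (after Thm 3.2)] -/
theorem eval_boundedDegreeSymbolD_eq_mul (κ : τ → ℕ) (T : MvPolynomial τ ℂ →ₗ[ℂ] MvPolynomial τ ℂ)
    (z : τ → ℂ) {w : τ → ℂ} (hw : ∀ i, w i ≠ 0) :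
    eval (Sum.elim z w) (boundedDegreeSymbolD κ T) =
      (∏ i, w i ^ κ i) * eval (Sum.elim z fun i => (w i)⁻¹) (boundedDegreeSymbol κ T) := by
  rw [eval_boundedDegreeSymbolD, eval_boundedDegreeSymbol, ← prod_pow_smul_prod_X_add_C_inv_pow κ hw,
    map_smul, smul_eval]

/-- `Re(1/w) > 0` iff … : inversion preserves the open right half-plane. [folklore] -/
private theorem inv_re_pos {w : ℂ} (hw : 0 < w.re) : 0 < (w⁻¹).re := by
  rw [Complex.inv_re]
  have hw0 : w ≠ 0 := fun h => by rw [h, Complex.zero_re] at hw; exact lt_irrefl _ hw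
  exact div_pos hw (Complex.normSq_pos.2 hw0)

/-- **For `C = H_{π/2}` the symbols `T[(1+zw)^κ]` and `T[(z+w)^κ]` are `C`-stable together** ("often more
convenient – but equivalent"). [cite: BorceaBranden2009II, §3 (after Thm 3.2)]
[cite: BorceaBranden2009, §6.1 Remark 6.1] -/
theorem isHThetaStable_pi_div_two_boundedDegreeSymbolD_iff (κ : τ → ℕ)
    (T : MvPolynomial τ ℂ →ₗ[ℂ] MvPolynomial τ ℂ) :
    IsHThetaStable (Real.pi / 2) (boundedDegreeSymbolD κ T) ↔
      IsHThetaStable (Real.pi / 2) (boundedDegreeSymbol κ T) := by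
  rw [isHThetaStable_pi_div_two_iff, isHThetaStable_pi_div_two_iff]
  have key : ∀ z w : τ → ℂ, (∀ i, 0 < (w i).re) →
      (eval (Sum.elim z w) (boundedDegreeSymbolD κ T) ≠ 0 ↔
        eval (Sum.elim z fun i => (w i)⁻¹) (boundedDegreeSymbol κ T) ≠ 0) := by
    intro z w hw
    have hw0 : ∀ i, w i ≠ 0 := fun i h => by
      have := hw i
      rw [h, Complex.zero_re] at this
      exact lt_irrefl _ this
    rw [eval_boundedDegreeSymbolD_eq_mul κ T z hw0, mul_ne_zero_iff]
    exact ⟨fun h => h.2, fun h => ⟨prod_ne_zero_iff.2 fun i _ => pow_ne_zero _ (hw0 i), h⟩⟩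
  constructor
  · intro h zw hzw
    have hw : ∀ i, 0 < ((zw (Sum.inr i))⁻¹).re := fun i => inv_re_pos (hzw (Sum.inr i))
    have h1 := (key (zw ∘ Sum.inl) (fun i => (zw (Sum.inr i))⁻¹) hw).1
      (h _ fun j => by
        rcases j with i | i
        · simpa only [Sum.elim_inl, Function.comp_apply] using hzw (Sum.inl i)
        · simpa only [Sum.elim_inr] using hw i)
    simp only [inv_inv] at h1
    rwa [show (Sum.elim (zw ∘ Sum.inl) fun i => zw (Sum.inr i)) = zw from Sum.elim_comp_inl_inr zw] at h1
  · intro h zw hzw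
    have hw : ∀ i, 0 < (zw (Sum.inr i)).re := fun i => hzw (Sum.inr i)
    have h1 := (key (zw ∘ Sum.inl) (fun i => zw (Sum.inr i)) hw).2
      (h _ fun j => by
        rcases j with i | i
        · simpa only [Sum.elim_inl, Function.comp_apply] using hzw (Sum.inl i)
        · simpa only [Sum.elim_inr] using inv_re_pos (hw i))
    rwa [show (Sum.elim (zw ∘ Sum.inl) fun i => zw (Sum.inr i)) = zw from Sum.elim_comp_inl_inr zw] at h1

/-! ## §3 Theorem 3.2 for `C = H_{π/2}` -/

/-- **Borcea–Brändén II, Theorem 3.2, `C = H_{π/2}` (every `κ ∈ ℕⁿ`).** A linear operator `T` on `ℂ[z_τ]` maps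
every `H_{π/2}`-stable polynomial of `ℂ_κ[z_τ]` (degree `≤ κ_i` in `z_i`) to an `H_{π/2}`-stable polynomial or
to `0` iff either (a) `T = α(·)P` on `ℂ_κ[z_τ]` for a linear functional `α` and an `H_{π/2}`-stable `P`, or
(b) `T[(1+zw)^κ]` is `H_{π/2}`-stable (in `2n` variables). ("Preserves `C`-stability" is read, as in part I
Theorem 1.1 and the tree's Theorem 3.1, as "`C`-stable or identically `0`".)
[cite: BorceaBranden2009II, §3 Thm 3.2] -/
theorem BorceaBranden_rightHalfPlaneStabilityPreserver_iff (κ : τ → ℕ)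
    (T : MvPolynomial τ ℂ →ₗ[ℂ] MvPolynomial τ ℂ) :
    (∀ p : MvPolynomial τ ℂ, (∀ i, degreeOf i p ≤ κ i) → IsHThetaStable (Real.pi / 2) p →
        IsHThetaStable (Real.pi / 2) (T p) ∨ T p = 0) ↔
      ((∃ (α : MvPolynomial τ ℂ →ₗ[ℂ] ℂ) (P : MvPolynomial τ ℂ), IsHThetaStable (Real.pi / 2) P ∧
          ∀ p : MvPolynomial τ ℂ, (∀ i, degreeOf i p ≤ κ i) → T p = α p • P) ∨
        IsHThetaStable (Real.pi / 2) (boundedDegreeSymbolD κ T)) := by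
  rw [BorceaBranden_hThetaStabilityPreserver_iff, isHThetaStable_pi_div_two_boundedDegreeSymbolD_iff]

/-- **Theorem 3.2 (`C = H_{π/2}`), unfolded**: with "`H_{π/2}`-stable" spelled out as non-vanishing whenever all
`Re z_i > 0`, and (b) as `T[Π_i (1 + w_i z_i)^{κ_i}](z) ≠ 0` for `Re z_i, Re w_i > 0`.
[cite: BorceaBranden2009II, §3 Thm 3.2] -/
theorem BorceaBranden_rightHalfPlaneStabilityPreserver_iff_re (κ : τ → ℕ)
    (T : MvPolynomial τ ℂ →ₗ[ℂ] MvPolynomial τ ℂ) :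
    (∀ p : MvPolynomial τ ℂ, (∀ i, degreeOf i p ≤ κ i) →
        (∀ z : τ → ℂ, (∀ i, 0 < (z i).re) → eval z p ≠ 0) →
          (∀ z : τ → ℂ, (∀ i, 0 < (z i).re) → eval z (T p) ≠ 0) ∨ T p = 0) ↔
      ((∃ (α : MvPolynomial τ ℂ →ₗ[ℂ] ℂ) (P : MvPolynomial τ ℂ),
          (∀ z : τ → ℂ, (∀ i, 0 < (z i).re) → eval z P ≠ 0) ∧
            ∀ p : MvPolynomial τ ℂ, (∀ i, degreeOf i p ≤ κ i) → T p = α p • P) ∨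
        ∀ z w : τ → ℂ, (∀ i, 0 < (z i).re) → (∀ i, 0 < (w i).re) →
          eval z (T (∏ i, (1 + C (w i) * X i) ^ κ i)) ≠ 0) := by
  have h2 := isHThetaStable_boundedDegreeSymbolD_iff (Real.pi / 2) κ T
  simp only [thetaUnit_pi_div_two, Complex.I_mul_im] at h2
  have h := BorceaBranden_rightHalfPlaneStabilityPreserver_iff κ T
  rw [h2] at h
  simp only [isHThetaStable_pi_div_two_iff] at h
  exact h

end Literature.Combinatorics.StablePolynomials

end
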